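import Literature.Probability.RandomPlanarGeometry.SAWFrames
import Mathlib.Data.Int.ModEq
import HarnessLib

/-!
# The boundary cycle of a lattice rectangle and its arcs (routing inside the arena)

Routing tool for the polygon-insertion surgery of H. Duminil-Copin, G. Kozma, A. Yadin,
*Supercritical self-avoiding walks are space-filling*, Ann. IHP Probab. Stat. 50 (2014), §3:
the two parallel lanes of the inserted excursion arrive at two adjacent sites of the boundary of
the (empty) arena and must be joined, by disjoint self-avoiding paths inside the arena, to the
two adjacent port sites of the merged structure. We walk along the BOUNDARY CYCLE of the arena:
for a rectangle `[xl, xr] × [yl, yu]` (frame coordinates, `xl < xr`, `yl < yu`) the clockwise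
parametrisation `Rect.cyc : ℤ → Site 2` of its boundary (period `P = 2(W+H)`; `Rect.idx` its
inverse on boundary sites) is a chain of adjacent sites, injective on any `P` consecutive
indices; `Rect.cwArc i n` / `Rect.ccwArc i n` are its arcs. The routing rule
(`Rect.routeCW`, `Rect.routeCCW`): from the clockwise-later arrival go clockwise to the first
port site met, from the other arrival go counter-clockwise to the first port site met; the two
arcs partition the cycle, so they are disjoint self-avoiding paths ending at the two port sites
(`Rect.routes_spec`).
-/

noncomputable section

open Finset Literature.Probability.LatticeModels

namespace Literature.Probability.RandomPlanarGeometry.SAW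

/-- A lattice rectangle `[xl, xr] × [yl, yu]` in the coordinates of a frame, with `xl < xr`,
`yl < yu`. [folklore] -/
structure Rect where
  /-- the frame -/
  F : Frame
  /-- left abscissa -/
  xl : ℤ
  /-- right abscissa -/
  xr : ℤ
  /-- bottom ordinate -/
  yl : ℤ
  /-- top ordinate -/
  yu : ℤ
  /-- non-degenerate horizontally -/
  hx : xl < xr
  /-- non-degenerate vertically -/
  hy : yl < yu

namespace Rect

variable (Q : Rect)

/-- Width `W = xr - xl`. [folklore] -/
def W : ℤ := Q.xr - Q.xl

/-- Height `H = yu - yl`. [folklore] -/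
def H : ℤ := Q.yu - Q.yl

/-- Perimeter `P = 2(W + H)`, the number of boundary sites. [folklore] -/
def P : ℤ := 2 * (Q.W + Q.H)

/-- The perimeter is at least `4`. [folklore] -/
theorem four_le_P : 4 ≤ Q.P := by
  have := Q.hx; have := Q.hy; simp only [P, W, H]; omega

/-- The perimeter is positive. [folklore] -/
theorem P_pos : 0 < Q.P := by have := Q.four_le_P; omega

/-- Abscissa of the `i`-th boundary site in clockwise order from the top-left corner
(`0 ≤ i < P`): top side eastwards, right side downwards, bottom side westwards, left side
upwards. [folklore] -/
def cxAt (i : ℤ) : ℤ :=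
  if i ≤ Q.W then Q.xl + i
  else if i ≤ Q.W + Q.H then Q.xr
  else if i ≤ 2 * Q.W + Q.H then Q.xr - (i - Q.W - Q.H)
  else Q.xl

/-- Ordinate of the `i`-th boundary site. [folklore] -/
def cyAt (i : ℤ) : ℤ :=
  if i ≤ Q.W then Q.yu
  else if i ≤ Q.W + Q.H then Q.yu - (i - Q.W)
  else if i ≤ 2 * Q.W + Q.H then Q.yl
  else Q.yl + (i - 2 * Q.W - Q.H)

/-- The clockwise boundary cycle, extended periodically to all of `ℤ`. [folklore] -/
def cyc (k : ℤ) : Site 2 := Q.F.fr (Q.cxAt (k % Q.P)) (Q.cyAt (k % Q.P))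

/-- A site lies on the boundary of the rectangle (in frame coordinates). [folklore] -/
def OnBdry (w : Site 2) : Prop :=
  Q.xl ≤ Q.F.fx w ∧ Q.F.fx w ≤ Q.xr ∧ Q.yl ≤ Q.F.fy w ∧ Q.F.fy w ≤ Q.yu ∧
    (Q.F.fx w = Q.xl ∨ Q.F.fx w = Q.xr ∨ Q.F.fy w = Q.yl ∨ Q.F.fy w = Q.yu)

/-- The clockwise index of a boundary site. [folklore] -/
def idx (w : Site 2) : ℤ :=
  if Q.F.fy w = Q.yu then Q.F.fx w - Q.xl
  else if Q.F.fx w = Q.xr then Q.W + (Q.yu - Q.F.fy w)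
  else if Q.F.fy w = Q.yl then Q.W + Q.H + (Q.xr - Q.F.fx w)
  else 2 * Q.W + Q.H + (Q.F.fy w - Q.yl)

/-- Reduction of the periodic index. [folklore] -/
theorem emod_bounds (k : ℤ) : 0 ≤ k % Q.P ∧ k % Q.P < Q.P :=
  ⟨Int.emod_nonneg _ Q.P_pos.ne', Int.emod_lt_of_pos _ Q.P_pos⟩

/-- The boundary sites are on the boundary. [folklore] -/
theorem at_onBdry {i : ℤ} (hi : 0 ≤ i ∧ i < Q.P) :
    Q.xl ≤ Q.cxAt i ∧ Q.cxAt i ≤ Q.xr ∧ Q.yl ≤ Q.cyAt i ∧ Q.cyAt i ≤ Q.yu ∧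
      (Q.cxAt i = Q.xl ∨ Q.cxAt i = Q.xr ∨ Q.cyAt i = Q.yl ∨ Q.cyAt i = Q.yu) := by
  have := Q.hx; have := Q.hy
  simp only [cxAt, cyAt, P, W, H] at *
  split_ifs <;> omega

/-- The index recovers the position. [folklore] -/
theorem idx_at {i : ℤ} (hi : 0 ≤ i ∧ i < Q.P) : Q.idx (Q.F.fr (Q.cxAt i) (Q.cyAt i)) = i := by
  have := Q.hx; have := Q.hy
  simp only [idx, Frame.fx_fr, Frame.fy_fr, cxAt, cyAt, P, W, H] at *
  split_ifs <;> omega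

/-- **Injectivity of the cycle on a period.** [folklore] -/
theorem cyc_inj {k k' : ℤ} (h : Q.cyc k = Q.cyc k') : k % Q.P = k' % Q.P := by
  have h1 := Q.idx_at (Q.emod_bounds k)
  have h2 := Q.idx_at (Q.emod_bounds k')
  simp only [cyc] at h
  rw [← h1, ← h2, h]

/-- Injectivity on a window of `P` consecutive indices. [folklore] -/
theorem cyc_injOn_window (a : ℤ) {k k' : ℤ} (hk : a ≤ k ∧ k < a + Q.P) (hk' : a ≤ k' ∧ k' < a + Q.P)
    (h : Q.cyc k = Q.cyc k') : k = k' := by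
  have he := Q.cyc_inj h
  have hP := Q.P_pos
  have h1 := Int.mul_ediv_add_emod k Q.P
  have h2 := Int.mul_ediv_add_emod k' Q.P
  set m := k / Q.P - k' / Q.P with hm
  have hkk : k - k' = Q.P * m := by rw [hm, mul_sub]; omega
  rcases lt_trichotomy m 0 with hlt | heq | hgt
  · have : Q.P * m ≤ Q.P * (-1) := mul_le_mul_of_nonneg_left (by omega) hP.le
    omega
  · rw [heq, mul_zero] at hkk; omega
  · have : Q.P * 1 ≤ Q.P * m := mul_le_mul_of_nonneg_left (by omega) hP.le
    omega

/-- Boundary sites of the cycle. [folklore] -/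
theorem cyc_onBdry (k : ℤ) : Q.OnBdry (Q.cyc k) := by
  have := Q.at_onBdry (Q.emod_bounds k)
  simp only [OnBdry, cyc, Frame.fx_fr, Frame.fy_fr]
  exact this

/-- The index of a boundary site lies in `[0, P)`. [folklore] -/
theorem idx_bounds {w : Site 2} (hw : Q.OnBdry w) : 0 ≤ Q.idx w ∧ Q.idx w < Q.P := by
  have := Q.hx; have := Q.hy
  obtain ⟨h1, h2, h3, h4, h5⟩ := hw
  simp only [idx, P, W, H]; split_ifs <;> omega

/-- The cycle passes through every boundary site: `cyc (idx w) = w`. [folklore] -/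
theorem cyc_idx {w : Site 2} (hw : Q.OnBdry w) : Q.cyc (Q.idx w) = w := by
  have := Q.hx; have := Q.hy
  have hidx := Q.idx_bounds hw
  obtain ⟨h1, h2, h3, h4, h5⟩ := hw
  rw [cyc, Int.emod_eq_of_lt hidx.1 hidx.2, eq_comm, Q.F.eq_fr_iff]
  simp only [idx, cxAt, cyAt, W, H] at *
  split_ifs at * <;> omega

/-- Consecutive boundary positions are adjacent sites. [folklore] -/
theorem adj_at_succ {i : ℤ} (hi : 0 ≤ i) (hi' : i + 1 < Q.P) :
    (zdGraph 2).Adj (Q.F.fr (Q.cxAt i) (Q.cyAt i)) (Q.F.fr (Q.cxAt (i + 1)) (Q.cyAt (i + 1))) := by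
  have := Q.hx; have := Q.hy; have := hi; have := hi'
  rw [Frame.adj_fr_iff]
  simp only [cxAt, cyAt, P, W, H] at *
  split_ifs <;> omega

/-- The last boundary position is adjacent to the first. [folklore] -/
theorem adj_at_last :
    (zdGraph 2).Adj (Q.F.fr (Q.cxAt (Q.P - 1)) (Q.cyAt (Q.P - 1))) (Q.F.fr (Q.cxAt 0) (Q.cyAt 0)) := by
  have := Q.hx; have := Q.hy
  rw [Frame.adj_fr_iff]
  simp only [cxAt, cyAt, P, W, H] at *
  split_ifs <;> omega

/-- **Consecutive sites of the cycle are adjacent.** [folklore] -/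
theorem adj_cyc_succ (k : ℤ) : (zdGraph 2).Adj (Q.cyc k) (Q.cyc (k + 1)) := by
  have hP := Q.four_le_P
  have hb := Q.emod_bounds k
  have h1P : (1 : ℤ) % Q.P = 1 := Int.emod_eq_of_lt (by omega) (by omega)
  have he : (k + 1) % Q.P = (k % Q.P + 1) % Q.P := by rw [Int.add_emod, h1P]
  simp only [cyc]
  rw [he]
  by_cases hwrap : k % Q.P + 1 < Q.P
  · rw [Int.emod_eq_of_lt (by omega) hwrap]
    exact Q.adj_at_succ hb.1 hwrap
  · have hlast : k % Q.P = Q.P - 1 := by omega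
    rw [hlast, show Q.P - 1 + 1 = Q.P by ring, Int.emod_self]
    exact Q.adj_at_last

/-- Congruent indices give the same site. [folklore] -/
theorem cyc_congr {k k' : ℤ} (h : k ≡ k' [ZMOD Q.P]) : Q.cyc k = Q.cyc k' := by
  unfold Int.ModEq at h
  simp only [cyc, h]

/-! ### Arcs -/

/-- The clockwise arc of `n` steps from index `i`. [folklore] -/
def cwArc (i : ℤ) (n : ℕ) : List (Site 2) := (List.range (n + 1)).map fun k : ℕ => Q.cyc (i + k)

/-- The counter-clockwise arc of `n` steps from index `i`. [folklore] -/
def ccwArc (i : ℤ) (n : ℕ) : List (Site 2) := (List.range (n + 1)).map fun k : ℕ => Q.cyc (i - k)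

/-- Membership in a clockwise arc. [folklore] -/
theorem mem_cwArc {i : ℤ} {n : ℕ} {w : Site 2} : w ∈ Q.cwArc i n ↔ ∃ k : ℕ, k ≤ n ∧ w = Q.cyc (i + k) := by
  simp only [cwArc, List.mem_map, List.mem_range]
  constructor
  · rintro ⟨k, hk, rfl⟩; exact ⟨k, by omega, rfl⟩
  · rintro ⟨k, hk, rfl⟩; exact ⟨k, by omega, rfl⟩

/-- Membership in a counter-clockwise arc. [folklore] -/
theorem mem_ccwArc {i : ℤ} {n : ℕ} {w : Site 2} :
    w ∈ Q.ccwArc i n ↔ ∃ k : ℕ, k ≤ n ∧ w = Q.cyc (i - k) := by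
  simp only [ccwArc, List.mem_map, List.mem_range]
  constructor
  · rintro ⟨k, hk, rfl⟩; exact ⟨k, by omega, rfl⟩
  · rintro ⟨k, hk, rfl⟩; exact ⟨k, by omega, rfl⟩

/-- Arcs are non-empty. [folklore] -/
theorem cwArc_ne_nil (i : ℤ) (n : ℕ) : Q.cwArc i n ≠ [] := by simp [cwArc]

/-- Arcs are non-empty. [folklore] -/
theorem ccwArc_ne_nil (i : ℤ) (n : ℕ) : Q.ccwArc i n ≠ [] := by simp [ccwArc]

/-- One more clockwise step. [folklore] -/
theorem cwArc_succ (i : ℤ) (n : ℕ) : Q.cwArc i (n + 1) = Q.cwArc i n ++ [Q.cyc (i + (n + 1 : ℕ))] := by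
  simp [cwArc, List.range_succ]

/-- One more counter-clockwise step. [folklore] -/
theorem ccwArc_succ (i : ℤ) (n : ℕ) : Q.ccwArc i (n + 1) = Q.ccwArc i n ++ [Q.cyc (i - (n + 1 : ℕ))] := by
  simp [ccwArc, List.range_succ]

/-- From the front: `cwArc i (n+1) = cyc i :: cwArc (i+1) n`. [folklore] -/
theorem cwArc_succ' (i : ℤ) (n : ℕ) : Q.cwArc i (n + 1) = Q.cyc i :: Q.cwArc (i + 1) n := by
  unfold cwArc
  rw [List.range_succ_eq_map, List.map_cons, List.map_map]
  simp only [Nat.cast_zero, add_zero, List.cons.injEq, true_and]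
  refine List.map_congr_left fun k _ => ?_
  simp only [Function.comp_apply, Nat.cast_succ]; ring_nf

/-- From the front: `ccwArc i (n+1) = cyc i :: ccwArc (i-1) n`. [folklore] -/
theorem ccwArc_succ' (i : ℤ) (n : ℕ) : Q.ccwArc i (n + 1) = Q.cyc i :: Q.ccwArc (i - 1) n := by
  unfold ccwArc
  rw [List.range_succ_eq_map, List.map_cons, List.map_map]
  simp only [Nat.cast_zero, sub_zero, List.cons.injEq, true_and]
  refine List.map_congr_left fun k _ => ?_
  simp only [Function.comp_apply, Nat.cast_succ]; ring_nf

/-- First site of a clockwise arc. [folklore] -/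
@[simp] theorem head?_cwArc (i : ℤ) (n : ℕ) : (Q.cwArc i n).head? = some (Q.cyc i) := by
  cases n with
  | zero => simp [cwArc]
  | succ n => rw [cwArc_succ']; rfl

/-- First site of a counter-clockwise arc. [folklore] -/
@[simp] theorem head?_ccwArc (i : ℤ) (n : ℕ) : (Q.ccwArc i n).head? = some (Q.cyc i) := by
  cases n with
  | zero => simp [ccwArc]
  | succ n => rw [ccwArc_succ']; rfl

/-- Last site of a clockwise arc. [folklore] -/
@[simp] theorem getLast?_cwArc (i : ℤ) (n : ℕ) : (Q.cwArc i n).getLast? = some (Q.cyc (i + n)) := by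
  cases n with
  | zero => simp [cwArc]
  | succ n => rw [cwArc_succ, List.getLast?_append]; simp

/-- Last site of a counter-clockwise arc. [folklore] -/
@[simp] theorem getLast?_ccwArc (i : ℤ) (n : ℕ) : (Q.ccwArc i n).getLast? = some (Q.cyc (i - n)) := by
  cases n with
  | zero => simp [ccwArc]
  | succ n => rw [ccwArc_succ, List.getLast?_append]; simp

/-- Clockwise arcs are chains. [folklore] -/
theorem isChain_cwArc (i : ℤ) (n : ℕ) : (Q.cwArc i n).IsChain (zdGraph 2).Adj := by
  induction n with
  | zero => simp [cwArc]
  | succ n ih =>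
    rw [cwArc_succ]
    refine List.IsChain.append ih (List.isChain_singleton _) fun x hx y hy => ?_
    rw [getLast?_cwArc] at hx
    simp only [Option.mem_def, Option.some.injEq, List.head?_cons] at hx hy
    subst hx; subst hy
    have := Q.adj_cyc_succ (i + n)
    rwa [show i + (n : ℤ) + 1 = i + ((n + 1 : ℕ) : ℤ) by push_cast; ring] at this

/-- Counter-clockwise arcs are chains. [folklore] -/
theorem isChain_ccwArc (i : ℤ) (n : ℕ) : (Q.ccwArc i n).IsChain (zdGraph 2).Adj := by
  induction n with
  | zero => simp [ccwArc]
  | succ n ih =>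
    rw [ccwArc_succ]
    refine List.IsChain.append ih (List.isChain_singleton _) fun x hx y hy => ?_
    rw [getLast?_ccwArc] at hx
    simp only [Option.mem_def, Option.some.injEq, List.head?_cons] at hx hy
    subst hx; subst hy
    have := Q.adj_cyc_succ (i - ((n + 1 : ℕ) : ℤ))
    rw [show i - ((n + 1 : ℕ) : ℤ) + 1 = i - (n : ℕ) by push_cast; ring] at this
    exact this.symm

/-- A clockwise arc shorter than the perimeter visits no site twice. [folklore] -/
theorem nodup_cwArc (i : ℤ) {n : ℕ} (hn : (n : ℤ) < Q.P) : (Q.cwArc i n).Nodup := by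
  refine List.Nodup.map_on (fun k hk k' hk' h => ?_) List.nodup_range
  rw [List.mem_range] at hk hk'
  have := Q.cyc_injOn_window i ⟨by omega, by omega⟩ ⟨by omega, by omega⟩ h
  omega

/-- A counter-clockwise arc shorter than the perimeter visits no site twice. [folklore] -/
theorem nodup_ccwArc (i : ℤ) {n : ℕ} (hn : (n : ℤ) < Q.P) : (Q.ccwArc i n).Nodup := by
  refine List.Nodup.map_on (fun k hk k' hk' h => ?_) List.nodup_range
  rw [List.mem_range] at hk hk'
  have := Q.cyc_injOn_window (i - n) ⟨by omega, by omega⟩ ⟨by omega, by omega⟩ h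
  omega

/-- Sites of arcs are on the boundary. [folklore] -/
theorem onBdry_of_mem_cwArc {i : ℤ} {n : ℕ} {w : Site 2} (h : w ∈ Q.cwArc i n) : Q.OnBdry w := by
  obtain ⟨k, -, rfl⟩ := Q.mem_cwArc.1 h; exact Q.cyc_onBdry _

/-- Sites of arcs are on the boundary. [folklore] -/
theorem onBdry_of_mem_ccwArc {i : ℤ} {n : ℕ} {w : Site 2} (h : w ∈ Q.ccwArc i n) : Q.OnBdry w := by
  obtain ⟨k, -, rfl⟩ := Q.mem_ccwArc.1 h; exact Q.cyc_onBdry _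

/-! ### The routing rule -/

/-- The clockwise offset `δ ∈ [0, P)` from the arrival pair (indices `i₀, i₀+1`) to the port pair
(indices `j, j+1`). [folklore] -/
def δ (i₀ j : ℤ) : ℤ := (j - i₀) % Q.P

/-- Bounds of the offset. [folklore] -/
theorem δ_bounds (i₀ j : ℤ) : 0 ≤ Q.δ i₀ j ∧ Q.δ i₀ j < Q.P := Q.emod_bounds _

/-- `i₀ + δ ≡ j`. [folklore] -/
theorem δ_modEq (i₀ j : ℤ) : i₀ + Q.δ i₀ j ≡ j [ZMOD Q.P] := by
  have h : (j - i₀) % Q.P ≡ j - i₀ [ZMOD Q.P] := Int.mod_modEq _ _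
  have := h.add_left i₀
  rw [δ]
  convert this using 1
  ring

/-- Length of the clockwise route: `δ - 1` (or `0` in the degenerate case `δ = 0`, when the port
pair is the arrival pair). [folklore] -/
def nCW (i₀ j : ℤ) : ℕ := if Q.δ i₀ j = 0 then 0 else (Q.δ i₀ j - 1).toNat

/-- Length of the counter-clockwise route: `P - 1 - δ` (or `0` if `δ = 0`). [folklore] -/
def nCCW (i₀ j : ℤ) : ℕ := if Q.δ i₀ j = 0 then 0 else (Q.P - 1 - Q.δ i₀ j).toNat

/-- The clockwise route, from the clockwise arrival `cyc (i₀ + 1)`. [folklore] -/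
def routeCW (i₀ j : ℤ) : List (Site 2) := Q.cwArc (i₀ + 1) (Q.nCW i₀ j)

/-- The counter-clockwise route, from the counter-clockwise arrival `cyc i₀`. [folklore] -/
def routeCCW (i₀ j : ℤ) : List (Site 2) := Q.ccwArc i₀ (Q.nCCW i₀ j)

/-- The clockwise route is non-empty. [folklore] -/
theorem routeCW_ne_nil (i₀ j : ℤ) : Q.routeCW i₀ j ≠ [] := Q.cwArc_ne_nil _ _

/-- The counter-clockwise route is non-empty. [folklore] -/
theorem routeCCW_ne_nil (i₀ j : ℤ) : Q.routeCCW i₀ j ≠ [] := Q.ccwArc_ne_nil _ _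

/-- **The routing rule.** The two routes are self-avoiding chains of boundary sites, start at the
two arrivals `cyc (i₀+1)` and `cyc i₀`, end at the two port sites `{cyc j, cyc (j+1)}` (one
each), and are disjoint (they are complementary arcs of the boundary cycle, or both trivial).
[folklore] -/
theorem routes_spec (i₀ j : ℤ) :
    (Q.routeCW i₀ j).IsChain (zdGraph 2).Adj ∧ (Q.routeCCW i₀ j).IsChain (zdGraph 2).Adj ∧
      (Q.routeCW i₀ j).Nodup ∧ (Q.routeCCW i₀ j).Nodup ∧
      (Q.routeCW i₀ j).head? = some (Q.cyc (i₀ + 1)) ∧ (Q.routeCCW i₀ j).head? = some (Q.cyc i₀) ∧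
      (((Q.routeCW i₀ j).getLast? = some (Q.cyc j) ∧ (Q.routeCCW i₀ j).getLast? = some (Q.cyc (j + 1))) ∨
        ((Q.routeCW i₀ j).getLast? = some (Q.cyc (j + 1)) ∧ (Q.routeCCW i₀ j).getLast? = some (Q.cyc j))) ∧
      List.Disjoint (Q.routeCW i₀ j) (Q.routeCCW i₀ j) ∧
      (∀ w ∈ Q.routeCW i₀ j, Q.OnBdry w) ∧ (∀ w ∈ Q.routeCCW i₀ j, Q.OnBdry w) := by
  have hδ := Q.δ_bounds i₀ j
  have hP := Q.four_le_P
  have hmod := Q.δ_modEq i₀ j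
  refine ⟨Q.isChain_cwArc _ _, Q.isChain_ccwArc _ _, Q.nodup_cwArc _ ?_, Q.nodup_ccwArc _ ?_,
    Q.head?_cwArc _ _, Q.head?_ccwArc _ _, ?_, ?_, fun w hw => Q.onBdry_of_mem_cwArc hw,
    fun w hw => Q.onBdry_of_mem_ccwArc hw⟩
  · simp only [nCW]; split_ifs <;> omega
  · simp only [nCCW]; split_ifs <;> omega
  · -- endpoints
    by_cases h0 : Q.δ i₀ j = 0
    · -- degenerate: the port pair is the arrival pair (`j ≡ i₀`)
      right
      rw [h0, add_zero] at hmod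
      simp only [routeCW, routeCCW, nCW, nCCW, h0, if_true, getLast?_cwArc, getLast?_ccwArc,
        Nat.cast_zero, add_zero, sub_zero]
      exact ⟨congrArg some (Q.cyc_congr (hmod.add_right 1)), congrArg some (Q.cyc_congr hmod)⟩
    · left
      simp only [routeCW, routeCCW, nCW, nCCW, h0, if_false, getLast?_cwArc, getLast?_ccwArc]
      rw [Int.toNat_of_nonneg (by omega), Int.toNat_of_nonneg (by omega)]
      refine ⟨congrArg some ?_, congrArg some ?_⟩
      · rw [show i₀ + 1 + (Q.δ i₀ j - 1) = i₀ + Q.δ i₀ j by ring]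
        exact Q.cyc_congr hmod
      · have h1 : i₀ - (Q.P - 1 - Q.δ i₀ j) ≡ i₀ + Q.δ i₀ j + 1 [ZMOD Q.P] := by
          rw [Int.modEq_iff_dvd]
          exact ⟨1, by ring⟩
        exact Q.cyc_congr (h1.trans (hmod.add_right 1))
  · -- disjointness: complementary index windows
    intro w hw hw'
    rw [routeCW, Q.mem_cwArc] at hw
    rw [routeCCW, Q.mem_ccwArc] at hw'
    obtain ⟨k, hk, rfl⟩ := hw
    obtain ⟨k', hk', heq⟩ := hw'
    by_cases h0 : Q.δ i₀ j = 0
    · simp only [nCW, nCCW, h0, if_true, Nat.le_zero] at hk hk'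
      subst hk; subst hk'
      simp only [Nat.cast_zero, add_zero, sub_zero] at heq
      have := Q.cyc_injOn_window i₀ ⟨by omega, by omega⟩ ⟨le_refl _, by omega⟩ heq
      omega
    · simp only [nCW, nCCW, h0, if_false] at hk hk'
      have hk1 : (k : ℤ) ≤ Q.δ i₀ j - 1 := by
        have := Int.toNat_of_nonneg (show 0 ≤ Q.δ i₀ j - 1 by omega); omega
      have hk2 : (k' : ℤ) ≤ Q.P - 1 - Q.δ i₀ j := by
        have := Int.toNat_of_nonneg (show 0 ≤ Q.P - 1 - Q.δ i₀ j by omega); omega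
      have := Q.cyc_injOn_window (i₀ + Q.δ i₀ j + 1 - Q.P) ⟨by omega, by omega⟩ ⟨by omega, by omega⟩ heq
      omega

/-- The port sites from their indices: if `X, Y` are boundary sites with `Y` the clockwise
successor of `X` (`idx Y ≡ idx X + 1`), then `cyc (idx X + 1) = Y`. [folklore] -/
theorem cyc_idx_succ {X Y : Site 2} (hY : Q.OnBdry Y) (h : Q.idx Y ≡ Q.idx X + 1 [ZMOD Q.P]) :
    Q.cyc (Q.idx X + 1) = Y := by
  rw [← Q.cyc_idx hY]
  exact Q.cyc_congr h.symm

end Rect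

end Literature.Probability.RandomPlanarGeometry.SAW
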